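import Summits.ValiantsHypothesis.ValiantsHypothesis.Theorems.SymPencilPerFourInnerRankTenFamily
import Mathlib.LinearAlgebra.Matrix.Nondegenerate

/-!
# Route `SymPencil` — inner rank of the `2 | 2` row split of `per_4`: reflected slices of a
# design are totally isotropic, and six independent slice vectors force twelve squares
# (`--supports` stmt-ValiantsHypothesis-5674 `SdcSuperquadratic`; (8,8) column of the size
# tables, cells `(8,8,10)` / `(8,8,11)`; rung currency only)

SETTING (as in `SymPencilPerFourInnerRankTenFamily`, `…PureSymm`).  A JOINT FAMILY is `c : ι → K`
and bilinear forms `t_r (u, y)`, `u = (a, b)`, `y = (y₂, y₃)`, with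
`Σ_r c_r t_r(u, y)² = per (a; b; y₂; y₃)` identically; write `⟨x, x'⟩ = Σ_r c_r x_r x'_r` on `K^ι`.

**Theorem 1** (`slice_isotropic`, `slice_isotropic_left`).  If `v, w ∈ K⁴` satisfy
`v_k w_l + v_l w_k = 0` for all `k ≠ l` — equivalently the symmetric matrix
`P(v, w) = (per (e_k; e_l; v; w))_{k,l}` vanishes, e.g. the REFLECTED PAIRS
`v = s e_i + t e_j`, `w = s e_i - t e_j` (`offDiag_reflect_pair`) — then the slice
`T_{(v,w)} = {(t_r(u, (v, w)))_r : u ∈ K⁸}` is totally isotropic: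
`⟨t(u,(v,w)), t(u',(v,w))⟩ = 0` for all `u, u'`; likewise the left slice
`{t((v,w), y) : y}`.  (Polarise the identity in `u`; the right-hand side is
`per (a; b'; v; w) + per (a'; b; v; w) = 0` because every `per (·; ·; v; w)` vanishes.)
No purity and no hypothesis on the weights `c_r` is used.

**Theorem 2** (`twelve_le_card_of_isotropic_six`, pure linear algebra).  If `u_1, …, u_6 ∈ K^ι`
are pairwise isotropic (`⟨u_m, u_m'⟩ = 0`) and there are test vectors `g_1, …, g_6` with
`det (⟨u_m, g_m'⟩) ≠ 0`, then `12 ≤ |ι|`: the map `ψ : x ↦ (⟨u_m, x⟩)_m` is onto `K⁶` (its values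
at the `g`'s are independent), the `u_m` are independent and lie in `ker ψ`, so `6 ≤ |ι| - 6`.

**Corollaries** (`twelve_le_card_of_slice`, `…_of_slice_left`, `false_of_slice_six`,
`false_of_reflect_pair_six`): a joint family with at most eleven squares has every reflected
slice of dimension at most five — six slice vectors `t(U_m, (v,w))` with an invertible pairing
matrix against any six test vectors are contradictory.  This is the CRITERION by which the pure
Gram problem P1 of the memo `NOTE-p6g15-5674-IR12-reduction.md` (pure designs need twelve
squares) is attacked in `NOTE-p8g14-5674-P1-structure.md`: at every known twelve-square pure
design (Laplace `c = c' = 0`; the sporadic design `c = c' = c₀/2` found there, where all eight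
coordinate slices `(e_k, e_k)` have dimension four) some reflected pair `(e_i + e_j, e_i - e_j)`
carries a six-dimensional slice, and no pure design with all reflected slices of dimension `≤ 5`
is known.

Honest framing: lemmas (a sufficient criterion); the cells `(8,8,10)`, `(8,8,11)` stay open; the
window `27 ≤ sdc(per_4) ≤ 29`, the crux `SdcSuperquadratic` and `VP ≠ VNP` are untouched.
No definitions, no named facts. [folklore]
-/

noncomputable section

-- single-conjunct layout: Sub = Summit, duplicated namespace component intended
set_option linter.dupNamespace false

namespace Summit.ValiantsHypothesis.ValiantsHypothesis.Theorems.SymPencilPerFourInnerRankIsotropicSlice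

open Matrix Finset Module
open Summit.ValiantsHypothesis.ValiantsHypothesis.Theorems.SymPencilPerFourInnerRankRows
open Summit.ValiantsHypothesis.ValiantsHypothesis.Theorems.SymPencilPerFourInnerRankTenFamily

variable {K : Type*} [Field K] {ι : Type*} [Fintype ι]

/-! ### Permanents with a pair of rows whose symmetrised product is diagonal -/

/-- If `v_k w_l + v_l w_k = 0` for all `k ≠ l` then `per (a; b; v; w) = 0`. [folklore] -/
theorem per_eq_zero_of_offDiag (a b v w : Fin 4 → K)
    (h : ∀ k l : Fin 4, k ≠ l → v k * w l + v l * w k = 0) :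
    (Matrix.of ![a, b, v, w]).permanent = 0 := by
  rw [permanent_of_rows, h 2 3 (by decide), h 1 3 (by decide), h 1 2 (by decide),
    h 0 3 (by decide), h 0 2 (by decide), h 0 1 (by decide)]
  ring

/-- If `a_k b_l + a_l b_k = 0` for all `k ≠ l` then `per (a; b; v; w) = 0` (swap the two row pairs,
cf. `SymPencilPerFourInnerRankSlots.per_swap_pairs`). [folklore] -/
theorem per_eq_zero_of_offDiag_left (a b v w : Fin 4 → K)
    (h : ∀ k l : Fin 4, k ≠ l → a k * b l + a l * b k = 0) :
    (Matrix.of ![a, b, v, w]).permanent = 0 := by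
  have hswap : (Matrix.of ![a, b, v, w]).permanent = (Matrix.of ![v, w, a, b]).permanent := by
    simp only [permanent_of_rows]; ring
  rw [hswap]
  exact per_eq_zero_of_offDiag v w a b h

/-- **Reflected pairs.**  `v = s e_i + t e_j`, `w = s e_i - t e_j` (`i ≠ j`) satisfy
`v_k w_l + v_l w_k = 0` for all `k ≠ l`. [folklore] -/
theorem offDiag_reflect_pair (i j : Fin 4) (hij : i ≠ j) (s₀ t₀ : K) (k l : Fin 4)
    (hkl : k ≠ l) :
    (s₀ • (Pi.single i 1 : Fin 4 → K) + t₀ • (Pi.single j 1 : Fin 4 → K)) k *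
        (s₀ • (Pi.single i 1 : Fin 4 → K) - t₀ • (Pi.single j 1 : Fin 4 → K)) l +
      (s₀ • (Pi.single i 1 : Fin 4 → K) + t₀ • (Pi.single j 1 : Fin 4 → K)) l *
        (s₀ • (Pi.single i 1 : Fin 4 → K) - t₀ • (Pi.single j 1 : Fin 4 → K)) k = 0 := by
  simp only [Pi.add_apply, Pi.sub_apply, Pi.smul_apply, Pi.single_apply, smul_eq_mul, mul_ite,
    mul_one, mul_zero]
  split_ifs <;> subst_vars <;>
    first
    | exact absurd rfl hkl
    | exact absurd rfl hij
    | ring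

/-! ### Polarisation in `u` and isotropy of slices -/

/-- **Polarisation of the joint identity in `u = (a, b)`.** [folklore] -/
theorem polar_left (c : ι → K)
    (t : ι → (((Fin 4 → K) × (Fin 4 → K)) →ₗ[K] ((Fin 4 → K) × (Fin 4 → K)) →ₗ[K] K))
    (hJ : ∀ a b y₂ y₃ : Fin 4 → K,
      ∑ r, c r * (t r (a, b) (y₂, y₃)) ^ 2 = (Matrix.of ![a, b, y₂, y₃]).permanent)
    (a b a' b' y₂ y₃ : Fin 4 → K) :
    2 * ∑ r, c r * t r (a, b) (y₂, y₃) * t r (a', b') (y₂, y₃) =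
      (Matrix.of ![a, b', y₂, y₃]).permanent + (Matrix.of ![a', b, y₂, y₃]).permanent := by
  have h1 := hJ (a + a') (b + b') y₂ y₃
  have h2 := hJ a b y₂ y₃
  have h3 := hJ a' b' y₂ y₃
  have hsplit : ∀ r, t r (a + a', b + b') (y₂, y₃) =
      t r (a, b) (y₂, y₃) + t r (a', b') (y₂, y₃) := fun r => by
    rw [← LinearMap.add_apply, ← map_add]; rfl
  simp_rw [hsplit] at h1
  -- `per` is additive in the rows `a` and `b`
  have hper : (Matrix.of ![a + a', b + b', y₂, y₃]).permanent =
      (Matrix.of ![a, b, y₂, y₃]).permanent + (Matrix.of ![a, b', y₂, y₃]).permanent +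
        ((Matrix.of ![a', b, y₂, y₃]).permanent + (Matrix.of ![a', b', y₂, y₃]).permanent) := by
    simp only [permanent_of_rows, Pi.add_apply]; ring
  rw [hper] at h1
  have hsq : ∑ r, c r * (t r (a, b) (y₂, y₃) + t r (a', b') (y₂, y₃)) ^ 2 =
      ∑ r, c r * (t r (a, b) (y₂, y₃)) ^ 2 +
        2 * ∑ r, c r * t r (a, b) (y₂, y₃) * t r (a', b') (y₂, y₃) +
        ∑ r, c r * (t r (a', b') (y₂, y₃)) ^ 2 := by
    rw [Finset.mul_sum, ← Finset.sum_add_distrib, ← Finset.sum_add_distrib]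
    exact Finset.sum_congr rfl fun r _ => by ring
  linear_combination h1 - h2 - h3 - hsq

/-- **Right slices with `P(v,w) = 0` are totally isotropic**: if `v_k w_l + v_l w_k = 0` for
`k ≠ l` then `⟨t(u,(v,w)), t(u',(v,w))⟩ = 0` for all `u, u' ∈ K⁸`. [folklore] -/
theorem slice_isotropic [CharZero K] (c : ι → K)
    (t : ι → (((Fin 4 → K) × (Fin 4 → K)) →ₗ[K] ((Fin 4 → K) × (Fin 4 → K)) →ₗ[K] K))
    (hJ : ∀ a b y₂ y₃ : Fin 4 → K,
      ∑ r, c r * (t r (a, b) (y₂, y₃)) ^ 2 = (Matrix.of ![a, b, y₂, y₃]).permanent)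
    (v w : Fin 4 → K) (h : ∀ k l : Fin 4, k ≠ l → v k * w l + v l * w k = 0)
    (u u' : (Fin 4 → K) × (Fin 4 → K)) :
    ∑ r, c r * t r u (v, w) * t r u' (v, w) = 0 := by
  obtain ⟨a, b⟩ := u
  obtain ⟨a', b'⟩ := u'
  have hp := polar_left c t hJ a b a' b' v w
  rw [per_eq_zero_of_offDiag a b' v w h, per_eq_zero_of_offDiag a' b v w h, add_zero] at hp
  exact (mul_eq_zero.1 hp).resolve_left two_ne_zero

/-- **Left slices with `P(a,b) = 0` are totally isotropic**: if `a_k b_l + a_l b_k = 0` for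
`k ≠ l` then `⟨t((a,b),y), t((a,b),y')⟩ = 0` for all `y, y' ∈ K⁸`. [folklore] -/
theorem slice_isotropic_left [CharZero K] (c : ι → K)
    (t : ι → (((Fin 4 → K) × (Fin 4 → K)) →ₗ[K] ((Fin 4 → K) × (Fin 4 → K)) →ₗ[K] K))
    (hJ : ∀ a b y₂ y₃ : Fin 4 → K,
      ∑ r, c r * (t r (a, b) (y₂, y₃)) ^ 2 = (Matrix.of ![a, b, y₂, y₃]).permanent)
    (a b : Fin 4 → K) (h : ∀ k l : Fin 4, k ≠ l → a k * b l + a l * b k = 0)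
    (y y' : (Fin 4 → K) × (Fin 4 → K)) :
    ∑ r, c r * t r (a, b) y * t r (a, b) y' = 0 := by
  obtain ⟨y₂, y₃⟩ := y
  obtain ⟨y₂', y₃'⟩ := y'
  have hp := polar c t hJ a b y₂ y₃ y₂' y₃'
  rw [per_eq_zero_of_offDiag_left a b y₂ y₃' h, per_eq_zero_of_offDiag_left a b y₂' y₃ h,
    add_zero] at hp
  exact (mul_eq_zero.1 hp).resolve_left two_ne_zero

/-! ### Six independent isotropic vectors force twelve coordinates -/

/-- **Linear algebra core.**  Six pairwise `⟨·,·⟩_c`-isotropic vectors `u_m ∈ K^ι` whose pairing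
matrix against six test vectors `g_m'` is invertible force `12 ≤ |ι|` (no hypothesis on the
weights `c_r`). [folklore] -/
theorem twelve_le_card_of_isotropic_six [DecidableEq ι] (c : ι → K) (u g : Fin 6 → ι → K)
    (hiso : ∀ m m' : Fin 6, ∑ r, c r * u m r * u m' r = 0)
    (hdet : (Matrix.of fun m m' : Fin 6 => ∑ r, c r * u m r * g m' r).det ≠ 0) :
    12 ≤ Fintype.card ι := by
  set P : Matrix (Fin 6) (Fin 6) K := Matrix.of fun m m' => ∑ r, c r * u m r * g m' r with hP
  -- `ψ x = (⟨u_m, x⟩)_m`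
  let ψ : (ι → K) →ₗ[K] (Fin 6 → K) :=
    { toFun := fun x m => ∑ r, c r * u m r * x r
      map_add' := fun x y => by
        funext m
        simp only [Pi.add_apply, mul_add, Finset.sum_add_distrib]
      map_smul' := fun s x => by
        funext m
        simp only [Pi.smul_apply, smul_eq_mul, RingHom.id_apply, Finset.mul_sum]
        exact Finset.sum_congr rfl fun r _ => by ring }
  have hψ : ∀ x m, ψ x m = ∑ r, c r * u m r * x r := fun x m => rfl
  -- the values `ψ (g m')` are the columns of `P`, hence independent, hence `ψ` is onto
  have hcol : ∀ m', ψ (g m') = P.col m' := fun m' => by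
    funext m; rw [hψ]; rfl
  have hli : LinearIndependent K (fun m' => ψ (g m')) := by
    rw [show (fun m' => ψ (g m')) = P.col from funext hcol]
    exact Matrix.linearIndependent_cols_of_det_ne_zero hdet
  have hrange : LinearMap.range ψ = ⊤ := by
    apply le_antisymm le_top
    have hspan : Submodule.span K (Set.range fun m' => ψ (g m')) = ⊤ :=
      hli.span_eq_top_of_card_eq_finrank' (by simp)
    rw [← hspan, Submodule.span_le]
    rintro _ ⟨m', rfl⟩
    exact LinearMap.mem_range_self ψ (g m')
  have hker : finrank K (LinearMap.ker ψ) + 6 = Fintype.card ι := by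
    have h := LinearMap.finrank_range_add_finrank_ker ψ
    rw [hrange, finrank_top, finrank_fintype_fun_eq_card, finrank_fintype_fun_eq_card,
      Fintype.card_fin] at h
    omega
  -- the `u m` are independent and lie in `ker ψ`
  have hu : LinearIndependent K u := by
    rw [Fintype.linearIndependent_iff]
    intro a ha m
    have hvec : a ᵥ* P = 0 := by
      funext m'
      rw [Matrix.vecMul_eq_sum]
      simp only [Finset.sum_apply, Pi.smul_apply, smul_eq_mul, hP, Matrix.of_apply,
        Pi.zero_apply]
      have h0 : ∑ r, c r * (∑ m, a m • u m) r * g m' r = 0 := by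
        rw [ha]; simp
      rw [← h0]
      simp only [Finset.sum_apply, Pi.smul_apply, smul_eq_mul, Finset.mul_sum, Finset.sum_mul]
      rw [Finset.sum_comm]
      exact Finset.sum_congr rfl fun r _ => Finset.sum_congr rfl fun m _ => by ring
    exact congr_fun (Matrix.eq_zero_of_vecMul_eq_zero hdet hvec) m
  have hle : Submodule.span K (Set.range u) ≤ LinearMap.ker ψ := by
    rw [Submodule.span_le]
    rintro _ ⟨m', rfl⟩
    rw [SetLike.mem_coe, LinearMap.mem_ker]
    funext m
    rw [hψ, Pi.zero_apply]
    exact hiso m m'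
  have h6 : finrank K (Submodule.span K (Set.range u)) = 6 := by
    rw [finrank_span_eq_card hu, Fintype.card_fin]
  have hmono := Submodule.finrank_mono hle
  omega

/-- **Six independent vectors in a reflected right slice force twelve squares.**  With
`v_k w_l + v_l w_k = 0` (`k ≠ l`), six slice vectors `t(U_m, (v,w))` whose pairing matrix
against six test vectors is invertible give `12 ≤ |ι|`. [folklore] -/
theorem twelve_le_card_of_slice [CharZero K] [DecidableEq ι] (c : ι → K)
    (t : ι → (((Fin 4 → K) × (Fin 4 → K)) →ₗ[K] ((Fin 4 → K) × (Fin 4 → K)) →ₗ[K] K))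
    (hJ : ∀ a b y₂ y₃ : Fin 4 → K,
      ∑ r, c r * (t r (a, b) (y₂, y₃)) ^ 2 = (Matrix.of ![a, b, y₂, y₃]).permanent)
    (v w : Fin 4 → K) (h : ∀ k l : Fin 4, k ≠ l → v k * w l + v l * w k = 0)
    (U : Fin 6 → (Fin 4 → K) × (Fin 4 → K)) (g : Fin 6 → ι → K)
    (hdet : (Matrix.of fun m m' : Fin 6 => ∑ r, c r * t r (U m) (v, w) * g m' r).det ≠ 0) :
    12 ≤ Fintype.card ι :=
  twelve_le_card_of_isotropic_six c (fun m r => t r (U m) (v, w)) g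
    (fun m m' => slice_isotropic c t hJ v w h (U m) (U m')) hdet

/-- **Six independent vectors in a reflected left slice force twelve squares.** [folklore] -/
theorem twelve_le_card_of_slice_left [CharZero K] [DecidableEq ι] (c : ι → K)
    (t : ι → (((Fin 4 → K) × (Fin 4 → K)) →ₗ[K] ((Fin 4 → K) × (Fin 4 → K)) →ₗ[K] K))
    (hJ : ∀ a b y₂ y₃ : Fin 4 → K,
      ∑ r, c r * (t r (a, b) (y₂, y₃)) ^ 2 = (Matrix.of ![a, b, y₂, y₃]).permanent)
    (a b : Fin 4 → K) (h : ∀ k l : Fin 4, k ≠ l → a k * b l + a l * b k = 0)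
    (Y : Fin 6 → (Fin 4 → K) × (Fin 4 → K)) (g : Fin 6 → ι → K)
    (hdet : (Matrix.of fun m m' : Fin 6 => ∑ r, c r * t r (a, b) (Y m) * g m' r).det ≠ 0) :
    12 ≤ Fintype.card ι :=
  twelve_le_card_of_isotropic_six c (fun m r => t r (a, b) (Y m)) g
    (fun m m' => slice_isotropic_left c t hJ a b h (Y m) (Y m')) hdet

/-- **At most eleven squares: every reflected right slice has dimension at most five** —
six slice vectors with an invertible pairing matrix are contradictory. [folklore] -/
theorem false_of_slice_six [CharZero K] [DecidableEq ι] (hι : Fintype.card ι ≤ 11) (c : ι → K)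
    (t : ι → (((Fin 4 → K) × (Fin 4 → K)) →ₗ[K] ((Fin 4 → K) × (Fin 4 → K)) →ₗ[K] K))
    (hJ : ∀ a b y₂ y₃ : Fin 4 → K,
      ∑ r, c r * (t r (a, b) (y₂, y₃)) ^ 2 = (Matrix.of ![a, b, y₂, y₃]).permanent)
    (v w : Fin 4 → K) (h : ∀ k l : Fin 4, k ≠ l → v k * w l + v l * w k = 0)
    (U : Fin 6 → (Fin 4 → K) × (Fin 4 → K)) (g : Fin 6 → ι → K)
    (hdet : (Matrix.of fun m m' : Fin 6 => ∑ r, c r * t r (U m) (v, w) * g m' r).det ≠ 0) :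
    False := by
  have h12 := twelve_le_card_of_slice c t hJ v w h U g hdet
  omega

/-- **Reflected coordinate pairs**: with `v = s e_i + t e_j`, `w = s e_i - t e_j` (`i ≠ j`), six
slice vectors `t(U_m,(v,w))` with an invertible pairing matrix contradict `|ι| ≤ 11`. [folklore] -/
theorem false_of_reflect_pair_six [CharZero K] [DecidableEq ι] (hι : Fintype.card ι ≤ 11)
    (c : ι → K)
    (t : ι → (((Fin 4 → K) × (Fin 4 → K)) →ₗ[K] ((Fin 4 → K) × (Fin 4 → K)) →ₗ[K] K))
    (hJ : ∀ a b y₂ y₃ : Fin 4 → K,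
      ∑ r, c r * (t r (a, b) (y₂, y₃)) ^ 2 = (Matrix.of ![a, b, y₂, y₃]).permanent)
    (i j : Fin 4) (hij : i ≠ j) (s₀ t₀ : K)
    (U : Fin 6 → (Fin 4 → K) × (Fin 4 → K)) (g : Fin 6 → ι → K)
    (hdet : (Matrix.of fun m m' : Fin 6 => ∑ r, c r *
        t r (U m) (s₀ • (Pi.single i 1 : Fin 4 → K) + t₀ • Pi.single j 1,
          s₀ • (Pi.single i 1 : Fin 4 → K) - t₀ • Pi.single j 1) * g m' r).det ≠ 0) :
    False :=
  false_of_slice_six hι c t hJ _ _ (fun k l hkl => offDiag_reflect_pair i j hij s₀ t₀ k l hkl)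
    U g hdet

end Summit.ValiantsHypothesis.ValiantsHypothesis.Theorems.SymPencilPerFourInnerRankIsotropicSlice

end
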